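import Summits.BirchSwinnertonDyer.BirchSwinnertonDyer.Theorems.ByReductionTypeAtTwoFineSelmerConjAAtTwoAdditivePotGoodClassNumberOneCriterionFrac
import Summits.BirchSwinnertonDyer.BirchSwinnertonDyer.Theorems.ByReductionTypeAtTwoFineSelmerConjAAtTwoAdditivePotGoodTwoLayerDoorFukudaRows
import HarnessLib

/-!
# Route `ByReductionTypeAtTwo` (rung K4), crux C1″ `FineSelmerConjAAtTwoAdditivePotGood` (item stmt-BirchSwinnertonDyer-22615):
# THE ODD-DISCRIMINANT DOOR FOR NON-MONOGENIC POINT FIELDS — `2 ∤ d_K` from an index-`2` witness, and the census row `306936ce1`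
# (`2` splits completely in `ℚ(P)`, `h = 6`): Fukuda's two-layer criterion in RANK form with `n₀ = 0` DISCHARGED by the kernel
# (a `--supports 22615` file; seat `bsd-2adic-k4-w1` GEN 6; sequel of `…ClassNumberOneCriterionFrac` §4 and `…TwoLayerDoorFukudaRows`)

HONEST FRAMING (cell `bsd-2adic`, D-0036/D-0054): §1 UNCONDITIONAL kernel lemmas; §2 conditional on `hLim2` (Lim 2017 Thm. 3.5 at `2`) BY NAME and
ONE displayed numeric equality `rank₂ Cl(ℚ(θ, √2)) = rank₂ Cl(ℚ(θ))` (census `cyc3 = [6]`, `cyc6 = [12]`: both `2`-ranks `1`; PARI, NOT kernel);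
closes nothing at the `∀`-level; nothing booked; BSD is not proved by any of this.

WHY A NEW DOOR. GEN 5 listed `306936ce1` as an «open-type» row: `2` splits completely in its `2`-torsion cubic field `F` (`d_F = −38367`), so `2`
is a common index divisor (Dedekind) — EVERY generator `θ` of `𝓞 F` has even index and even `disc`, and the tree's discharger
`forall_totallyRamifiedFrom_zero_adjoin_of_odd_cubic_discr` (`2 ∤ disc`) can never apply, although `d_F` itself is odd. §1 repairs this:
`exists_sq_mul_discr_eq_of_intElem` (`disc = (k m')² d_K` from an algebraic integer `(x + yθ + zθ²)/k`, `(x,y,z) ≢ 0 mod k`) and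
`not_dvd_discr_of_intElem` (`k³ ∤ disc ⟹ k ∤ d_K`). §2: for `θ³ − 21θ − 84 = 0` (`disc = −153468 = 4·(−38367)`, `ω = (θ + θ²)/2 ∈ 𝓞 F`)
this gives `2 ∤ d_F`, hence `n₀ = 0` (`IwasawaTheory.totallyRamifiedFrom_zero_of_not_dvd_discr`, p687770), and the RANK-form two-layer door
(`fineSelmerDual_moduleFinite_two_of_totallyRamified_of_rank_succ_eq_pointField`, Fukuda Thm. 1 (2) `_holds`) yields (A)₂ for `306936ce1` from the
single displayed equality — the row moves from «open type» to the Fukuda rows (census: 11 open-type rows → 10).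

References: [Marcus1977] Ch. 2 Exercise 27, Thm. 13; [Cohen1993] §6.2; [Fukuda1994] Thm. 1 (2); [Washington1997] §13.1; [Lim2017FineSelmer]
Thm. 3.5, Lemma 3.2; [CoatesSujatha2005] (A).
-/

set_option autoImplicit false
-- sibling precedent (`…ClassNumberOneCriterionFrac.lean`): the directory name repeats the summit name
set_option linter.dupNamespace false

noncomputable section

open scoped Classical IntermediateField NumberField Real nonZeroDivisors

namespace Summit.BirchSwinnertonDyer.BirchSwinnertonDyer.Theorems.AddKatoTwo

open WeierstrassCurve Field Polynomial IsDedekindDomain NumberField Matrix Literature.NumberTheory.EllipticCurves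
  Literature.NumberTheory.GaloisRepresentations
  Literature.NumberTheory.IwasawaTheory
  Summit.BirchSwinnertonDyer.BirchSwinnertonDyer.Theorems.AlignedTransportAtTwoTorsionPointField
  Summit.BirchSwinnertonDyer.BirchSwinnertonDyer.Theses.ByReductionTypeAtTwo

/-! ## §1 The index witness and the discriminant -/

section Discriminant

variable (K : Type) [Field K] [NumberField K]

/-- **`disc = (k·m')² · d_K` with `m' ≠ 0`** when an algebraic integer `ω = (x + yθ + zθ²)/k` with `(x, y, z) ≢ 0 (mod k)` (`k` prime)
witnesses `k ∣ [𝓞 K : ℤ[θ]]`: the equality form of `sq_mul_abs_discr_le_abs_cubic_discr` (same proof: `(x, y, z) mod k` is a non-zero vector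
in the left kernel of the matrix of `1, θ, θ²` in an integral basis, reduced mod `k`). [cite: Marcus1977, Ch. 2 Exercise 27 and Thm. 13] -/
theorem exists_sq_mul_discr_eq_of_intElem (h3 : Module.finrank ℚ K = 3) (b : 𝓞 K) {p q r : ℤ}
    (hirr : Irreducible (Cubic.toPoly ⟨1, (p : ℚ), q, r⟩)) (hb : b ^ 3 + p * b ^ 2 + q * b + r = 0)
    {k : ℕ} (hk : k.Prime) (x y z : ℤ) (hω : ∃ ω : 𝓞 K, (k : 𝓞 K) * ω = (x : 𝓞 K) + y * b + z * b ^ 2)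
    (hnd : ¬ ((k : ℤ) ∣ x ∧ (k : ℤ) ∣ y ∧ (k : ℤ) ∣ z)) :
    ∃ m' : ℤ, m' ≠ 0 ∧ ((k : ℤ) * m') ^ 2 * NumberField.discr K = Cubic.discr ⟨1, p, q, r⟩ := by
  set θ : K := (b : K) with hθdef
  have hfm : (Cubic.toPoly ⟨1, (p : ℚ), q, r⟩).Monic := Cubic.monic_of_a_eq_one'
  have hθK : θ ^ 3 + (p : K) * θ ^ 2 + (q : K) * θ + (r : K) = 0 := by
    have := congrArg (algebraMap (𝓞 K) K) hb
    simpa [hθdef] using this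
  have hθQ : θ ^ 3 + ((p : ℚ) : K) * θ ^ 2 + ((q : ℚ) : K) * θ + ((r : ℚ) : K) = 0 := by
    push_cast; exact hθK
  have hxroot : aeval θ (Cubic.toPoly ⟨1, (p : ℚ), q, r⟩) = 0 := by
    simp only [Cubic.toPoly, map_one, one_mul, aeval_add, aeval_mul, aeval_C, aeval_X_pow, aeval_X,
      eq_ratCast, Rat.cast_intCast]
    exact hθK
  have hint : IsIntegral ℚ θ := ⟨_, hfm, by rwa [← aeval_def]⟩
  have hmin : minpoly ℚ θ = Cubic.toPoly ⟨1, (p : ℚ), q, r⟩ := (minpoly.eq_of_irreducible_of_monic hirr hxroot hfm).symm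
  have hnd3 : (minpoly ℚ θ).natDegree = 3 := by rw [hmin]; exact Cubic.natDegree_of_a_ne_zero' one_ne_zero
  have hli : LinearIndependent ℚ fun i : Fin 3 => θ ^ (i : ℕ) := by
    have hcomp : (fun i : Fin 3 => θ ^ (i : ℕ)) ∘ (finCongr hnd3) =
        fun i : Fin (minpoly ℚ θ).natDegree => θ ^ (i : ℕ) := by
      funext i; simp
    have h0 : LinearIndependent ℚ fun i : Fin (minpoly ℚ θ).natDegree => θ ^ (i : ℕ) := linearIndependent_pow θ
    rw [← hcomp] at h0
    exact (linearIndependent_equiv (finCongr hnd3)).mp h0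
  let b3 : Module.Basis (Fin 3) ℚ K := basisOfLinearIndependentOfCardEqFinrank hli (by simp [h3])
  have hb3 : ∀ i, b3 i = θ ^ (i : ℕ) := fun i => by
    simp [b3, coe_basisOfLinearIndependentOfCardEqFinrank]
  have hdisc : Algebra.discr ℚ ⇑b3 = Cubic.discr ⟨1, (p : ℚ), q, r⟩ := discr_powers_eq_cubic_discr θ b3 hb3 hθQ
  have hcard : Fintype.card (Module.Free.ChooseBasisIndex ℤ (𝓞 K)) = 3 := by
    rw [← Module.finrank_eq_card_chooseBasisIndex, RingOfIntegers.rank, h3]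
  let e : Module.Free.ChooseBasisIndex ℤ (𝓞 K) ≃ Fin 3 := Fintype.equivFinOfCardEq hcard
  let B3 : Module.Basis (Fin 3) ℤ (𝓞 K) := (RingOfIntegers.basis K).reindex e
  let I3 : Module.Basis (Fin 3) ℚ K := (integralBasis K).reindex e
  have hI3 : ∀ j, I3 j = algebraMap (𝓞 K) K (B3 j) := fun j => by
    simp [I3, B3, integralBasis_apply]
  have hdI : Algebra.discr ℚ ⇑I3 = NumberField.discr K := by
    simp only [I3, Module.Basis.coe_reindex, Algebra.discr_reindex, coe_discr]
  let P : Matrix (Fin 3) (Fin 3) ℤ := Matrix.of fun i j => B3.repr (b ^ (i : ℕ)) j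
  have hP : ∀ i j, P i j = B3.repr (b ^ (i : ℕ)) j := fun i j => rfl
  have hvec : ⇑b3 = (P.map (Int.cast : ℤ → ℚ)).map (algebraMap ℚ K) *ᵥ ⇑I3 := by
    funext i
    rw [hb3, Matrix.mulVec, dotProduct]
    have hsum := B3.sum_repr (b ^ (i : ℕ))
    have := congrArg (algebraMap (𝓞 K) K) hsum
    rw [map_sum] at this
    rw [hθdef, ← map_pow, ← this]
    refine Finset.sum_congr rfl fun j _ => ?_
    rw [hI3, Matrix.map_apply, Matrix.map_apply, hP, map_zsmul, zsmul_eq_mul, map_intCast]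
  have key := Algebra.discr_of_matrix_mulVec ⇑I3 (P.map (Int.cast : ℤ → ℚ))
  rw [← hvec, hdisc, hdI] at key
  have hdet : (P.map (Int.cast : ℤ → ℚ)).det = ((P.det : ℤ) : ℚ) := by
    have := RingHom.map_det (Int.castRingHom ℚ) P
    rw [RingHom.mapMatrix_apply, Int.coe_castRingHom] at this
    exact this.symm
  rw [hdet] at key
  have hQ : Cubic.discr ⟨1, (p : ℚ), q, r⟩ = ((Cubic.discr ⟨1, p, q, r⟩ : ℤ) : ℚ) := by
    simp only [Cubic.discr]; push_cast; ring
  rw [hQ] at key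
  have keyZ : Cubic.discr ⟨1, p, q, r⟩ = P.det ^ 2 * NumberField.discr K := by exact_mod_cast key
  -- `k ∣ det P`: `(x, y, z) mod k` is in the left kernel of `P mod k`
  have hdiv : (k : ℤ) ∣ P.det := by
    obtain ⟨ω, hω⟩ := hω
    have hT : (x : 𝓞 K) + y * b + z * b ^ 2 = x • b ^ ((0 : Fin 3) : ℕ) + y • b ^ ((1 : Fin 3) : ℕ) + z • b ^ ((2 : Fin 3) : ℕ) := by
      simp [zsmul_eq_mul]
    have hcoord : ∀ j, (k : ℤ) ∣ x * P 0 j + y * P 1 j + z * P 2 j := by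
      intro j
      have h1 : B3.repr ((x : 𝓞 K) + y * b + z * b ^ 2) j = x * P 0 j + y * P 1 j + z * P 2 j := by
        rw [hT, map_add, map_add, map_zsmul, map_zsmul, map_zsmul, Finsupp.add_apply, Finsupp.add_apply,
          Finsupp.smul_apply, Finsupp.smul_apply, Finsupp.smul_apply, smul_eq_mul, smul_eq_mul, smul_eq_mul, hP, hP, hP]
      have h2 : B3.repr ((x : 𝓞 K) + y * b + z * b ^ 2) j = (k : ℤ) * B3.repr ω j := by
        rw [← hω, show ((k : ℕ) : 𝓞 K) * ω = (k : ℤ) • ω by simp [zsmul_eq_mul], map_zsmul, Finsupp.smul_apply,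
          smul_eq_mul]
      rw [← h1, h2]
      exact Dvd.intro _ rfl
    haveI : Fact k.Prime := ⟨hk⟩
    set v : Fin 3 → ZMod k := ![(x : ZMod k), (y : ZMod k), (z : ZMod k)] with hv
    have hv0 : v ≠ 0 := by
      intro h0
      apply hnd
      have h0' : ∀ i, v i = 0 := fun i => by rw [h0]; rfl
      refine ⟨?_, ?_, ?_⟩
      · exact (ZMod.intCast_zmod_eq_zero_iff_dvd x k).mp (by simpa [hv] using h0' 0)
      · exact (ZMod.intCast_zmod_eq_zero_iff_dvd y k).mp (by simpa [hv] using h0' 1)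
      · exact (ZMod.intCast_zmod_eq_zero_iff_dvd z k).mp (by simpa [hv] using h0' 2)
    have hvP : v ᵥ* ((Int.castRingHom (ZMod k)).mapMatrix P) = 0 := by
      funext j
      rw [Matrix.vecMul, dotProduct, Fin.sum_univ_three]
      simp only [hv, RingHom.mapMatrix_apply, Matrix.map_apply, eq_intCast, Matrix.cons_val_zero, Matrix.cons_val_one,
        Matrix.cons_val_two, Matrix.tail_cons, Matrix.head_cons, Pi.zero_apply]
      obtain ⟨c, hc⟩ := hcoord j
      have := congrArg (Int.cast : ℤ → ZMod k) hc
      push_cast at this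
      rw [this, ZMod.natCast_self, zero_mul]
    have hdet0 : ((Int.castRingHom (ZMod k)).mapMatrix P).det = 0 :=
      Matrix.exists_vecMul_eq_zero_iff.mp ⟨v, hv0, hvP⟩
    rw [← RingHom.map_det] at hdet0
    exact (ZMod.intCast_zmod_eq_zero_iff_dvd _ k).mp hdet0
  obtain ⟨m', hm'⟩ := hdiv
  have hm'0 : m' ≠ 0 := by
    rintro rfl
    rw [mul_zero] at hm'
    have hne := Algebra.discr_not_zero_of_basis ℚ b3
    rw [hdisc, hQ, keyZ, hm'] at hne
    simp at hne
  exact ⟨m', hm'0, by rw [← hm', keyZ]⟩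

/-- **`k ∤ d_K` from an index witness and `k³ ∤ disc`**: with `ω` as above, `disc = k²·m'²·d_K`, so `k ∣ d_K` would force `k³ ∣ disc`.
For the census field of `306936ce1` (`2` splits completely, so EVERY `θ` has even index and even `disc`): `k = 2`, `disc/4` odd ⟹ `d_K` odd.
[cite: Marcus1977, Ch. 2 Exercise 27] [cite: Cohen1993, §6.2 (Dedekind's example: common index divisors)] -/
theorem not_dvd_discr_of_intElem (h3 : Module.finrank ℚ K = 3) (b : 𝓞 K) {p q r : ℤ}
    (hirr : Irreducible (Cubic.toPoly ⟨1, (p : ℚ), q, r⟩)) (hb : b ^ 3 + p * b ^ 2 + q * b + r = 0)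
    {k : ℕ} (hk : k.Prime) (x y z : ℤ) (hω : ∃ ω : 𝓞 K, (k : 𝓞 K) * ω = (x : 𝓞 K) + y * b + z * b ^ 2)
    (hnd : ¬ ((k : ℤ) ∣ x ∧ (k : ℤ) ∣ y ∧ (k : ℤ) ∣ z)) (h3k : ¬ ((k : ℤ) ^ 3 ∣ Cubic.discr ⟨1, p, q, r⟩)) :
    ¬ ((k : ℤ) ∣ NumberField.discr K) := by
  obtain ⟨m', -, hm'⟩ := exists_sq_mul_discr_eq_of_intElem K h3 b hirr hb hk x y z hω hnd
  rintro ⟨d, hd⟩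
  apply h3k
  refine ⟨m' ^ 2 * d, ?_⟩
  rw [← hm', hd]
  ring

end Discriminant

/-! ## §2 The census row `306936ce1` -/

/-- The census curve `306936ce1`: `y² = x³ + (-9901143)x + (-11991571830)` is an elliptic curve (the `AddKatoTwo` copy of k4-w2's `isElliptic_306936ce1`). -/
theorem isElliptic_306936ce1' : (⟨0, ((0 : ℤ) : ℚ), 0, ((-9901143 : ℤ) : ℚ), ((-11991571830 : ℤ) : ℚ)⟩ : WeierstrassCurve ℚ).IsElliptic :=
  isElliptic_cubicModel _ _ _ (by simp only [Cubic.discr]; norm_num)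

/-- `X³ + (0)X² + (-21)X + (-84)` is irreducible over `ℚ` (no root mod `11`). -/
theorem irreducible_cubic_d38367n : Irreducible (Cubic.toPoly ⟨1, ((0 : ℤ) : ℚ), ((-21 : ℤ) : ℚ), ((-84 : ℤ) : ℚ)⟩) :=
  haveI : Fact (Nat.Prime 11) := ⟨by norm_num⟩
  irreducible_cubic_of_no_root_zmod 11 (by decide)

/-- **(A)₂ for `306936ce1` from Fukuda's two-layer criterion in RANK form with `n₀ = 0` DISCHARGED by the odd-discriminant door — ONE displayed
numeric equality** (an «open-type» row of GEN 5's census: `2` splits completely in `ℚ(P)`, `d = −38367`, `h = 6`; k4-w2's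
`bsdp_two_306936ce1_of_conjA` consumes (A)₂). Granted `hLim2`; displayed: `rank₂ Cl(ℚ(θ, √2)) = rank₂ Cl(ℚ(θ))` (census `cyc3 = [6]`,
`cyc6 = [12]`), `θ` any root of `X³ − 21X − 84`. KERNEL: `ℚ(P) = ℚ(β) = ℚ(θ)` (`β = -903 + (765/2)θ + (129/2)θ²` a root of the `2`-division cubic),
`2 ∤ d_{ℚ(θ)}` (§1 with `ω = (θ + θ²)/2`, `disc = −153468 = 4·(−38367)`), hence `n₀ = 0` (p687770), Fukuda Thm. 1 (2) (`_holds`).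
[cite: Lim2017FineSelmer, §3 Thm. 3.5 and Lemma 3.2] [cite: Fukuda1994, Thm. 1 (2), p. 264] [cite: Washington1997, §13.1 Lemma 13.3] -/
theorem conjA_two_306936ce1_of_fukudaLayers
    (hLim2 : Lim2017.thm35_at_two_fineSelmerDual_moduleFinite_of_classicalMuVanishes_of_le_divisionField_four)
    {θ : AlgebraicClosure ℚ} (hθ : aeval θ (Cubic.toPoly ⟨1, ((0 : ℤ) : ℚ), ((-21 : ℤ) : ℚ), ((-84 : ℤ) : ℚ)⟩) = 0)
    (h01 : haveI : FiniteDimensional ℚ (IntermediateField.adjoin ℚ {θ}) :=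
        IntermediateField.adjoin.finiteDimensional ((AlgebraicClosure.isAlgebraic ℚ).isAlgebraic θ).isIntegral
      haveI : NumberField (IntermediateField.adjoin ℚ {θ}) := NumberField.mk
      ∀ κL : ZpExtension (IntermediateField.adjoin ℚ {θ}) 2, κL.IsCyclotomic → classGroupPRank κL 1 = classGroupPRank κL 0)
    (κ : ZpExtension ℚ 2) (hκ : κ.IsCyclotomic) :
    haveI := isElliptic_306936ce1'
    ∃ (γ : absoluteGaloisGroup ℚ) (D : (⟨0, ((0 : ℤ) : ℚ), 0, ((-9901143 : ℤ) : ℚ), ((-11991571830 : ℤ) : ℚ)⟩ : WeierstrassCurve ℚ).FineSelmerDualData κ γ),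
      Module.Finite ℤ_[2] (RestrictScalars ℤ_[2] (IwasawaAlgebra 2) D.X) := by
  haveI := isElliptic_306936ce1'
  have hθ' : θ ^ 3 + (0 : AlgebraicClosure ℚ) * θ ^ 2 + (-21 : AlgebraicClosure ℚ) * θ + (-84 : AlgebraicClosure ℚ) = 0 := by
    have := hθ
    simp only [Cubic.toPoly, map_one, one_mul, aeval_add, aeval_mul, aeval_C, aeval_X_pow, aeval_X,
      eq_ratCast, Rat.cast_intCast] at this
    push_cast at this
    linear_combination this
  set β : AlgebraicClosure ℚ := algebraMap ℚ (AlgebraicClosure ℚ) (-903 : ℚ) +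
      algebraMap ℚ (AlgebraicClosure ℚ) (765 / 2 : ℚ) * θ + algebraMap ℚ (AlgebraicClosure ℚ) (129 / 2 : ℚ) * θ ^ 2 with hβdef
  have hβ : aeval β (Cubic.toPoly ⟨1, ((0 : ℤ) : ℚ), ((-9901143 : ℤ) : ℚ), ((-11991571830 : ℤ) : ℚ)⟩) = 0 := by
    simp only [Cubic.toPoly, map_one, one_mul, aeval_add, aeval_mul, aeval_C, aeval_X_pow, aeval_X, eq_ratCast,
      Rat.cast_intCast]
    rw [hβdef]
    simp only [eq_ratCast]
    push_cast
    linear_combination ((45085167 : AlgebraicClosure ℚ) + ((90700803 : AlgebraicClosure ℚ) / 4) * θ + ((38191095 : AlgebraicClosure ℚ) / 8) * θ ^ 2 + ((2146689 : AlgebraicClosure ℚ) / 8) * θ ^ 3) * hθ'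
  have hadj : IntermediateField.adjoin ℚ {β} = IntermediateField.adjoin ℚ {θ} := by
    apply le_antisymm
    · rw [IntermediateField.adjoin_simple_le_iff, hβdef]
      have hθmem := IntermediateField.mem_adjoin_simple_self ℚ θ
      exact add_mem (add_mem (algebraMap_mem _ _) (mul_mem (algebraMap_mem _ _) hθmem))
        (mul_mem (algebraMap_mem _ _) (pow_mem hθmem 2))
    · rw [IntermediateField.adjoin_simple_le_iff]
      have hθeq : θ = algebraMap ℚ (AlgebraicClosure ℚ) (15768487 / 174 : ℚ) +
          algebraMap ℚ (AlgebraicClosure ℚ) (26041 / 1044 : ℚ) * β +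
          algebraMap ℚ (AlgebraicClosure ℚ) (-43 / 3132 : ℚ) * β ^ 2 := by
        rw [hβdef]; simp only [eq_ratCast]; push_cast
        linear_combination (((157165 : AlgebraicClosure ℚ) / 232) + ((79507 : AlgebraicClosure ℚ) / 1392) * θ) * hθ'
      rw [hθeq]
      have hβmem := IntermediateField.mem_adjoin_simple_self ℚ β
      exact add_mem (add_mem (algebraMap_mem _ _) (mul_mem (algebraMap_mem _ _) hβmem))
        (mul_mem (algebraMap_mem _ _) (pow_mem hβmem 2))
  obtain ⟨P₀, hP₀, hP₀eq⟩ := exists_geomTorsion_two_eq_some_root ((0 : ℤ) : ℚ) ((-9901143 : ℤ) : ℚ)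
    ((-11991571830 : ℤ) : ℚ) hβ
  have hF : IntermediateField.fixedField (MulAction.stabilizer (absoluteGaloisGroup ℚ) P₀) =
      IntermediateField.adjoin ℚ {θ} := by
    rw [fixedField_stabilizer_eq_adjoin_root _ _ _ hβ hP₀eq, ← hadj]
    -- the two `Algebra ℚ ℚ̄` instance paths agree
    congr 1
  have hirr := irreducible_cubic_d38367n
  haveI : FiniteDimensional ℚ (IntermediateField.adjoin ℚ {θ}) :=
    IntermediateField.adjoin.finiteDimensional ((AlgebraicClosure.isAlgebraic ℚ).isAlgebraic θ).isIntegral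
  haveI : NumberField (IntermediateField.adjoin ℚ {θ}) := NumberField.mk
  obtain ⟨B, -, hB⟩ := exists_ringOfIntegers_cubic_root (p := 0) (q := -21) (r := -84) hθ
  have h3 := finrank_adjoin_eq_three_of_irreducible hirr hθ
  -- `ω = (θ + θ²)/2 ∈ 𝓞 ℚ(θ)`: `2 ∣ [𝓞 : ℤ[θ]]`, `disc = 4 · (−38367)`, so `2 ∤ d`
  obtain ⟨ω, hω, -⟩ := exists_intElem_of_scaled_cubic _ B 0 1 1 (m := 2) (by norm_num) (-21) 42 (-672)
    (by push_cast; linear_combination (((64 : ℤ) : 𝓞 (IntermediateField.adjoin ℚ {θ})) + ((-18 : ℤ) : 𝓞 (IntermediateField.adjoin ℚ {θ})) * B + ((3 : ℤ) : 𝓞 (IntermediateField.adjoin ℚ {θ})) * B ^ 2 + ((1 : ℤ) : 𝓞 (IntermediateField.adjoin ℚ {θ})) * B ^ 3) * hB)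
  have hodd : ¬ ((2 : ℤ) ∣ NumberField.discr (IntermediateField.adjoin ℚ {θ})) := by
    have := not_dvd_discr_of_intElem _ h3 B hirr hB Nat.prime_two 0 1 1 ⟨ω, hω⟩ (by norm_num)
      (by simp only [Cubic.discr]; norm_num)
    exact_mod_cast this
  exact fineSelmerDual_moduleFinite_two_of_totallyRamified_of_rank_succ_eq_pointField hLim2 _ hP₀ hF
    (fun κL hκL => totallyRamifiedFrom_zero_of_not_dvd_discr (by rw [h3]; norm_num) hodd κL hκL) h01 κ hκ

end Summit.BirchSwinnertonDyer.BirchSwinnertonDyer.Theorems.AddKatoTwo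

end
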